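import Summits.BirchSwinnertonDyer.Rank1Residual.Additive.X4ThreeKuriharaRoute1Record22077e1
import Summits.BirchSwinnertonDyer.Rank1Residual.GaloisImage.KuriharaRecordCorollaryThreeWith
import HarnessLib

/-!
# N11 LOWER@3 — the T-PORT-FIX PILOT RECORD: the ROUTE-1 parity-form record `BSD(E,3)` for `22077e1`
# at its printed Kolyvagin level `139·151 = 20989`, RE-KEYED on the repaired port (shared generator `η`)
# (cell `b2b-bsdres`, team n1011, seat p03 GEN 13; lead R5-110 (n3)(δ) / R5-112 (a): "after (2) lands
# p03 files ONE re-keyed record file as the PILOT"; planner r1 GEN 47 (R-ii) / GEN 48 (R-ii″); sibling of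
# the landed `Additive/X4ThreeKuriharaRoute1Record22077e1.lean` (p03 gen 6), which is NOT edited and NOT
# re-submitted; consumer BY NAME of n1011-p18's re-keyed record corollary
# `GaloisImage/KuriharaRecordCorollaryThreeWith.lean` (T-PORT-FIX tool (2)))

HONEST FRAMING (cell `b2b-bsdres`, run/shared/lean/b2b/bsd-rank1-residual/, verbatim in every
file): the goal of the cell is to DELETE the COMBINATION-SHAPED residual classes of the
Birch–Swinnerton-Dyer formula for ALL analytic-rank `≤ 1` elliptic curves over `ℚ` — "full BSD
formula for every rank `≤ 1` curve in class `C`" assembled STRICTLY from published theorems — so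
that the rank-`≤ 1` remainder becomes exactly the CONSTRUCTION-SHAPED classes, which are TYPED
(missing-input `Prop`s), NOT attempted. This is not "finishing BSD". Team n1011 is a RESEARCH ROUTE;
no claim beyond the stated classes; the label X4 and the mark of RESIDUAL-MAP §I N11 (LOWER@3) are
UNCHANGED; a PER-PAIR record, not a class theorem; an EVIDENCE-grade booking CANDIDATE for the
director, nothing is booked by this file. Theorems only (no definition, no named fact).

## Why this file exists (the PORT anomaly, 2026-08-22)

n1011-p11 GEN 11 showed (09:48Z; PORT keeper r1 GEN 47 CONFIRMED 09:56Z, referee-1 GEN 48 CONFIRMED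
independently; kernel refutation `GaloisImage/KatoKuriharaPortThreeRefutation.lean`, p326481) that the
universal-closure port `KatoKuriharaPortThreeAt W t v₃` — binding `∀ k k′ D D′ red` with each guard
carrying its OWN `∃ η` — is UNSATISFIABLE on its population (two data canonical for `η` and `η⁻¹` exist on
one prime set, and the printed finite-singular comparison flips sign).  Lead R5-110 (n3)(δ): every record
displaying the bare `hPort : KatoKuriharaPortThreeAt …` is 'VACUOUS AS DISPLAYED pending PORT′ re-key'
— it closed nothing and un-closes nothing.  The REPAIR (T-PORT-FIX, owner n1011-p18 GEN 10): the
shared-generator closure `KatoKuriharaPortThreeAtWith W t v₃ η` (PORT′, p326602) and its form KEYED AT ONE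
PARAMETRISATION DATUM `KatoKuriharaPortThreeAtWith₂ W t v₃ η P` (PORT″, p327498; joint text (ii-b) of lead R5-112 (a):
keyed at the record's own `P` so that its named discharger ★ PK-6₂ reaches it) for ONE displayed generator family
`(η) (hη : ∀ 𝔮, ⟨η 𝔮⟩ = (ℤ/N𝔮)ˣ)` — the printed comparison ([MazurRubin2004] §1 / [Kim2022StructureSelmer]
Thm. 3.13) read in one coordinate `σ_η`; the sign mechanism cannot touch two data canonical for the SAME
`η` — with the tower packaging `TowerPackage.exists_towerFamily_with` (tool (1)) and the record corollary
`Assembly.exists_LOmega_padicValRat_le_of_towerSurj[_of_pair]_with` (tool (2), PORT″ currency over the P-keyed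
`…At` lower-bound chain) re-keyed by ONE binder.

## What this file does (re-key spec (R-ii″) and NOTHING ELSE)

`bsdp3_route1_v22077e1_of_conductor_with` and `bsdp3_route1_v22077e1_of_conductorCert_with` = the two
PARITY-FORM records `bsdp3_route1_v22077e1_of_conductor` / `…_of_conductorCert` of the landed sibling
file — the ONLY record declarations of the tree that consume the record corollary (2) DIRECTLY (no END
chain in between) — with the binder `(hPort : KatoKuriharaPortThreeAt W 0 v₃)` REPLACED by
`(η) (hη) (hPort : KatoKuriharaPortThreeAtWith₂ W 0 v₃ η D)`: binder diff EXACTLY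
{`hPort : PORT`} ↦ {`η`, `hη`, `hPort : PORT″ η D`}; every other binder, the conclusion `BSDp W 3` and the
proof are the landed ones token for token, the one line
`obtain ⟨q₀, hq₀, hw⟩ := Assembly.exists_LOmega_padicValRat_le_of_towerSurj_of_pair_with … η hη hPort …`
re-threaded.  IN THE KERNEL for this pair (BY NAME from the landed files, nothing restated): the integer
model, `3 ∣ Δ`, `3 ∣ c₄` (ADDITIVE at `3`), the `3`-adic tower `towerSurj3_v22077e1`, `∏ c_ℓ = 2`
(`tamagawaProduct_v22077e1`), the LEVEL `20989 = 139·151 ∈ 𝒩₁(E,3)` with cyclicity at both primes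
(`isKolyvaginProduct_one_v22077e1`, `forall_card_torsion_le_v22077e1`), `#E(ℚ₃)[3] = 1`
(`LocalTorsion3.natCard_threeTorsion_22077e1`), the rank-`0` Fricke sign `w_N f = −f` (p03 T-R1-55 via
`atkinLehnerInvolution_eq_neg_of_conductorNorm_eq`) which DISCHARGES the two single-prime vanishings by
additive-p4's parity lemma inside (2), and — in the `_of_conductorCert_with` form — the conductor
`N_E = 22077` (p18's kernel certificate `IntModelCond.conductorNorm_22077e1`).  DISPLAYED: the UPPER-half
facts of the X4 chain of record {`hKatoS`, `hDel`, `hmodD`, `hL20`, `hKatoχ`} with `hGZK`, `hmod`, `h26`;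
the LOWER-half facts `hS24` / `hS24₂` ([Sakamoto2024] Thm. 4.4 (1)(2)); the Poitou–Tate families
`inv…` / `inv'…`; Tate's `hEP` (kept as in (2) — the re-key changes ONE binder and nothing else; the tree
theorem p300886 would discharge it); the ONE repaired port `hPort : KatoKuriharaPortThreeAtWith₂ W 0 v₃ η D`
(FLAG `K22-Thm3.13-PORT@3`, ledger rider R-a: the SAME debt line as before); EVIDENCE binders per pair:
`hr : r_an = 0`, the OPTIMAL datum `D`/`hopt` at level `22077 ≤ 130000` (Cremona `opt_man`), and the VALUE
`hδ : ∃ ψ onto, δ̃_{20989}(ψ) ≢ 0 (mod 3)` ([Kim2025RefinedTNC] App. §8.1.1 PRINT × n1011-p08 engine 2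
j122130 × cc-eng-6 KURX j121455 — provenance only, no preprint is an input).

MEASURED COST of the re-key (the lead's post-review input, R5-110 (n3)(δ)): reported on the filing line.
Nothing is booked; the port, the PT families, `hEP`, [S24] and the UPPER-half facts are NOT discharged
here; X4 stays CONSTRUCTION-SHAPED; CERTIFICATE-EVIDENCE tier exactly as the sibling.

References: [Kim2022StructureSelmer] Thm. 1.9 (6), §1.2.2, Thm. 3.13; [Sakamoto2024] Thm. 4.4;
[MazurRubin2004] Def. 3.1.3, Thm. 3.2.4; [Kato2004Asterisque] Thm. 14.5 (3); [Delbourgo1998] Prop. 4;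
[Wuthrich2014] Lemma 20; [AgasheRibetStein2006] Thm. 2.6; [AtkinLehner1970] Thm. 3; [Miller2011LMS]
Def. 1.1; [CremonaAlgorithms1997] Table 1; cells/n1011/PLAN.md R5-110 / R5-112; ROUTE-1.md §59.
-/

set_option autoImplicit false

noncomputable section

open scoped Classical NumberField

open Function NumberField IsDedekindDomain WeierstrassCurve
  Literature.NumberTheory.EllipticCurves Literature.NumberTheory.EllipticCurves.ModularForms
  Literature.NumberTheory.EllipticCurves.Rank1Residual
  Literature.NumberTheory.EllipticCurves.AgasheRibetStein2006
  Literature.NumberTheory.GaloisRepresentations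
  Literature.NumberTheory.GaloisRepresentations.DiscreteGaloisModule Literature.NumberTheory.GaloisCohomology
  IsDedekindDomain.HeightOneSpectrum Rat.HeightOneSpectrum
  Summit.BirchSwinnertonDyer.Rank1Residual.GaloisImage Summit.BirchSwinnertonDyer.Rank1Residual.X4

namespace Summit.BirchSwinnertonDyer.Rank1Residual.Additive.X4ThreeKuriharaCert

/-- `20989 = 139·151` has exactly two prime factors (the sibling's private lemma, re-proved here). [folklore] -/
private theorem card_primeFactors_20989_with : (20989 : ℕ).primeFactors.card = 2 := by
  rw [show (20989 : ℕ) = 139 * 151 by norm_num, Nat.primeFactors_mul (by norm_num) (by norm_num),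
    Nat.Prime.primeFactors (by norm_num), Nat.Prime.primeFactors (by norm_num)]
  decide

/-- **T-PORT-FIX PILOT RECORD, PARITY FORM: `BSD(E,3)` for `22077e1` at `20989 = 139·151`, keyed on the
REPAIRED port** — the landed `bsdp3_route1_v22077e1_of_conductor` (any globally minimal elliptic `W/ℚ`
with Cremona's integral model `[0, 0, 1, -5376115974, -151721379981842]`, `N = 22077 = 3²·11·223`,
ADDITIVE at `3`, potentially good, `∏ c_ℓ = 2`, `#Ш_an = 81`) with binder diff EXACTLY
{`hPort : KatoKuriharaPortThreeAt W 0 v₃`} ↦ {`η`, `hη`, `hPort : KatoKuriharaPortThreeAtWith₂ W 0 v₃ η D`}: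
n1011-p18's re-keyed corollary `Assembly.exists_LOmega_padicValRat_le_of_towerSurj_of_pair_with` (ν(n) = 2;
the vanishing of `δ̃_{139}`, `δ̃_{151}` DISCHARGED by additive-p4's parity lemma from the rank-`0` Fricke
sign `w_N f = −f`, itself a THEOREM from `L(E,1) ≠ 0` ⟸ `r_an = 0` and `D.isNewformOf`, p03 T-R1-55)
with the extra binder `hNE : W.conductorNorm ℤ = 22077` (Cremona; discharged in `…_of_conductorCert_with`),
then additive-p4's socket `X4RankZero.bsdp_three_of_towerSurj_of_optimal_of_LOmegaWitness`.  Curve side BY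
NAME from the kernel (Addv, tower, `3 ∤ ∏c`, `20989 ∈ 𝒩₁`, cyclicity, `#E(ℚ₃)[3] = 1`); DISPLAYED: the
named facts {`hKatoS`, `hDel`, `hmodD`, `hL20`, `hKatoχ`, `hGZK`, `hmod`, `h26`, `hS24`, `hS24₂`}, the
Poitou–Tate families, `hEP`, the ONE repaired port (FLAG `K22-Thm3.13-PORT@3`) with its generator family
`η`/`hη`, and the EVIDENCE binders `hr`, `D`/`hopt`, the VALUE `δ̃_{20989}(ψ) ≢ 0 (mod 3)` (print × engine 2
× KURX).  CERTIFICATE-EVIDENCE; nothing booked; no mark moved; replaces nothing (its bare-PORT sibling stays,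
flagged vacuous as displayed). [cite: Kim2022StructureSelmer, Thm. 1.9 (6), §1.2.2 and Thm. 3.13]
[cite: Sakamoto2024, Thm. 4.4 (p. 926)] [cite: Kato2004Asterisque, Thm. 14.5 (3) (p. 236)]
[cite: AgasheRibetStein2006, Thm. 2.6 (p. 619)] [cite: AtkinLehner1970, Thm. 3] [cite: CremonaAlgorithms1997, Table 1] -/
theorem bsdp3_route1_v22077e1_of_conductor_with
    (hKatoS : Kato2004.rankZero_padicValNat_sha_le_sub_localTamagawa_of_additive_potGood_of_imageContainsSL2)
    (hDel : Delbourgo1998.prop4_rankZero_pow_dvd_constantCoeff)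
    (hGZK : rank_eq_analyticRank_of_analyticRank_le_one) (hmod : hasEntireLFunction_rat)
    (hmodD : nonempty_modularParametrizationData)
    (hL20 : Wuthrich2014.lemma20_surjective_threeAdic_of_semistable)
    (hKatoχ : Wuthrich2014.kato_halfEigenCharIdeal_dvd_cyclotomicPrime_of_surjective)
    (h26 : cremona_abs_maninConstant_eq_one_of_level_le)
    (hS24 : Sakamoto2024.kolyvaginSystems_freeRankOne_zmod_three_pow)
    (hS24₂ : Sakamoto2024.kolyvaginSystems_idealOfBasis_eq_fittingIdeal_zmod_three_pow)
    {W : WeierstrassCurve ℚ} [W.IsElliptic] [W.IsGloballyMinimal]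
    (hI : integralModelInt W = ⟨0, 0, 1, -5376115974, -151721379981842⟩)
    (hNE : W.conductorNorm ℤ = 22077) (hr : W.analyticRank = 0)
    (D : ModularParametrizationData W 22077)
    (hopt : ∀ z ∈ D.L.lattice, ∃ w ∈ periodLattice D.f, z = D.c * w)
    (inv : LocalInvariants ℚ 3) (hperf : inv.IsPerfect) (hsum : inv.SumLocalTermEqZero)
    (hcompl : inv.SelmerComplement)
    (inv' : ∀ k' : ℕ, LocalInvariants ℚ (3 ^ (k' + 1))) (hperf' : ∀ k', (inv' k').IsPerfect)
    (hsum' : ∀ k', (inv' k').SumLocalTermEqZero) (hcompl' : ∀ k', (inv' k').SelmerComplement)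
    (hinj' : ∀ k', ∀ v : HeightOneSpectrum (𝓞 ℚ), Injective (inv' k' (Sum.inr v)))
    (hEP : ∀ v : HeightOneSpectrum (𝓞 ℚ), localEulerPoincareCharacteristic (v.adicCompletion ℚ))
    (v₃ : HeightOneSpectrum (𝓞 ℚ)) (hv₃ : ((3 : ℕ) : 𝓞 ℚ) ∈ v₃.asIdeal)
    -- the ONE repaired port: a displayed generator family `η` and the shared-`η` closure
    (η : (q : HeightOneSpectrum (𝓞 ℚ)) → (ZMod (Ideal.absNorm q.asIdeal))ˣ)
    (hη : ∀ q : HeightOneSpectrum (𝓞 ℚ), Subgroup.zpowers (η q) = ⊤)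
    (hPort : KatoKuriharaPortThreeAtWith₂ W 0 v₃ η D)
    (hδ : ∃ ψ : (ℓ : ℕ) → (ZMod ℓ)ˣ →* Multiplicative (ZMod (3 ^ 1)),
      (∀ ℓ ∈ (20989 : ℕ).primeFactors, Function.Surjective (ψ ℓ)) ∧
        kuriharaNumber D.f (3 ^ 1) 20989 ψ ≠ 0) :
    haveI : Fact (Nat.Prime 3) := ⟨Nat.prime_three⟩
    BSDp W 3 := by
  haveI : Fact (Nat.Prime 3) := ⟨Nat.prime_three⟩
  haveI : NeZero (20989 : ℕ) := ⟨by norm_num⟩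
  obtain ⟨ψ, hψ, hcert⟩ := hδ
  have hadd : Addv W 3 := addv_of_intModel hI 3 (by decide +kernel) (by decide +kernel)
  have htam : ¬ 3 ∣ W.tamagawaProduct := by rw [tamagawaProduct_v22077e1 hI]; decide
  have hc3 : ¬ 3 ∣ (W.baseChange ℚ_[3]).localTamagawaNumber ℤ_[3] := fun h =>
    htam (h.trans (localTamagawaNumber_padic_dvd_tamagawaProduct W 3))
  have htower : ∀ m : ℕ, W.HasSurjectiveModNGaloisRep (3 ^ m : ℕ) := towerSurj3_v22077e1 hI
  have hsurj : W.HasSurjectiveModNGaloisRep 3 := by simpa using htower 1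
  have ht0 : Nat.card {Q : (W.baseChange ℚ_[3]).toAffine.Point // (3 : ℕ) • Q = 0} = 1 :=
    (LocalTorsion3.natCard_threeTorsion_22077e1 W hI).trans (pow_zero 3)
  have hL : W.entireLFunction 1 ≠ 0 := (W.analyticRank_eq_zero_iff_holds (hmod W)).mp hr
  have hε : atkinLehnerInvolution 22077 2 22077 D.f = -D.f :=
    atkinLehnerInvolution_eq_neg_of_conductorNorm_eq hNE D.f D.isNewformOf hL
  obtain ⟨q₀, hq₀, hw⟩ := Assembly.exists_LOmega_padicValRat_le_of_towerSurj_of_pair_with hS24 hS24₂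
    hGZK hmod h26 W hadd hc3 htower ht0 hr (by norm_num) D hopt hNE hε inv hperf hsum hcompl inv' hperf'
    hsum' hcompl' hinj' hEP v₃ hv₃ η hη hPort 20989 (isKolyvaginProduct_one_v22077e1 hI)
    card_primeFactors_20989_with (forall_card_torsion_le_v22077e1 hI) ψ hψ hcert
  exact X4RankZero.bsdp_three_of_towerSurj_of_optimal_of_LOmegaWitness W hKatoS hDel hGZK hmod hmodD
    hL20 hKatoχ h26 hadd hsurj htower hr htam (by norm_num) ⟨D, hopt⟩ hq₀ hw

/-- **T-PORT-FIX PILOT RECORD, PARITY FORM, CONDUCTOR CERTIFIED: `BSD(E,3)` for `22077e1` at `20989`,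
keyed on the REPAIRED port** — `bsdp3_route1_v22077e1_of_conductor_with` with its binder
`hNE : W.conductorNorm ℤ = 22077` DISCHARGED by n1011-p18's kernel conductor certificate
`IntModelCond.conductorNorm_22077e1` (row T-NCOND; Tate at `11, 223`, Kraus / Papadopoulos at `2, 3`,
run on `integralModelInt W`; no named fact) = the landed `bsdp3_route1_v22077e1_of_conductorCert` with
binder diff EXACTLY {`hPort : KatoKuriharaPortThreeAt W 0 v₃`} ↦ {`η`, `hη`,
`hPort : KatoKuriharaPortThreeAtWith₂ W 0 v₃ η D`}.  Its ONLY evidence binders are `hr`, `D`/`hopt` and the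
VALUE `δ̃_{20989}(ψ) ≢ 0 (mod 3)` (print × engine 2 × KURX); the named-fact hypotheses are the (M) / E1
sockets', unchanged; the port is the repaired one (FLAG `K22-Thm3.13-PORT@3`).  CERTIFICATE-EVIDENCE;
nothing booked; no mark moved. [cite: Kim2022StructureSelmer, Thm. 1.9 (6), §1.2.2 and Thm. 3.13]
[cite: Sakamoto2024, Thm. 4.4 (p. 926)] [cite: Kato2004Asterisque, Thm. 14.5 (3) (p. 236)]
[cite: AgasheRibetStein2006, Thm. 2.6 (p. 619)] [cite: AtkinLehner1970, Thm. 3] [cite: CremonaAlgorithms1997, Table 1] -/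
theorem bsdp3_route1_v22077e1_of_conductorCert_with
    (hKatoS : Kato2004.rankZero_padicValNat_sha_le_sub_localTamagawa_of_additive_potGood_of_imageContainsSL2)
    (hDel : Delbourgo1998.prop4_rankZero_pow_dvd_constantCoeff)
    (hGZK : rank_eq_analyticRank_of_analyticRank_le_one) (hmod : hasEntireLFunction_rat)
    (hmodD : nonempty_modularParametrizationData)
    (hL20 : Wuthrich2014.lemma20_surjective_threeAdic_of_semistable)
    (hKatoχ : Wuthrich2014.kato_halfEigenCharIdeal_dvd_cyclotomicPrime_of_surjective)
    (h26 : cremona_abs_maninConstant_eq_one_of_level_le)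
    (hS24 : Sakamoto2024.kolyvaginSystems_freeRankOne_zmod_three_pow)
    (hS24₂ : Sakamoto2024.kolyvaginSystems_idealOfBasis_eq_fittingIdeal_zmod_three_pow)
    {W : WeierstrassCurve ℚ} [W.IsElliptic] [W.IsGloballyMinimal]
    (hI : integralModelInt W = ⟨0, 0, 1, -5376115974, -151721379981842⟩)
    (hr : W.analyticRank = 0)
    (D : ModularParametrizationData W 22077)
    (hopt : ∀ z ∈ D.L.lattice, ∃ w ∈ periodLattice D.f, z = D.c * w)
    (inv : LocalInvariants ℚ 3) (hperf : inv.IsPerfect) (hsum : inv.SumLocalTermEqZero)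
    (hcompl : inv.SelmerComplement)
    (inv' : ∀ k' : ℕ, LocalInvariants ℚ (3 ^ (k' + 1))) (hperf' : ∀ k', (inv' k').IsPerfect)
    (hsum' : ∀ k', (inv' k').SumLocalTermEqZero) (hcompl' : ∀ k', (inv' k').SelmerComplement)
    (hinj' : ∀ k', ∀ v : HeightOneSpectrum (𝓞 ℚ), Injective (inv' k' (Sum.inr v)))
    (hEP : ∀ v : HeightOneSpectrum (𝓞 ℚ), localEulerPoincareCharacteristic (v.adicCompletion ℚ))
    (v₃ : HeightOneSpectrum (𝓞 ℚ)) (hv₃ : ((3 : ℕ) : 𝓞 ℚ) ∈ v₃.asIdeal)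
    (η : (q : HeightOneSpectrum (𝓞 ℚ)) → (ZMod (Ideal.absNorm q.asIdeal))ˣ)
    (hη : ∀ q : HeightOneSpectrum (𝓞 ℚ), Subgroup.zpowers (η q) = ⊤)
    (hPort : KatoKuriharaPortThreeAtWith₂ W 0 v₃ η D)
    (hδ : ∃ ψ : (ℓ : ℕ) → (ZMod ℓ)ˣ →* Multiplicative (ZMod (3 ^ 1)),
      (∀ ℓ ∈ (20989 : ℕ).primeFactors, Function.Surjective (ψ ℓ)) ∧
        kuriharaNumber D.f (3 ^ 1) 20989 ψ ≠ 0) :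
    haveI : Fact (Nat.Prime 3) := ⟨Nat.prime_three⟩
    BSDp W 3 :=
  bsdp3_route1_v22077e1_of_conductor_with hKatoS hDel hGZK hmod hmodD hL20 hKatoχ h26 hS24 hS24₂ hI
    (IntModelCond.conductorNorm_22077e1 W hI) hr D hopt inv hperf hsum hcompl inv' hperf' hsum' hcompl'
    hinj' hEP v₃ hv₃ η hη hPort hδ

end Summit.BirchSwinnertonDyer.Rank1Residual.Additive.X4ThreeKuriharaCert

end
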